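import Summits.BirchSwinnertonDyer.BirchSwinnertonDyer.Theorems.EisensteinPrimesLineCharactersWeilRelation
import Summits.BirchSwinnertonDyer.BirchSwinnertonDyer.Theorems.EisensteinPrimesLinePhiAtMultiplicativePrime
import Summits.BirchSwinnertonDyer.BirchSwinnertonDyer.Theorems.EisensteinPrimesFullDescentMultiplicativeUnipotentLine
import Summits.BirchSwinnertonDyer.Rank1Residual.X2.ResidualLineCharactersOdd
import Summits.BirchSwinnertonDyer.Rank1Residual.X2.IsogenyLineType
import Summits.BirchSwinnertonDyer.Rank1Residual.X2.Cells
import Literature.NumberTheory.EllipticCurves.Rank1Residual.GVParityTwistProofs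
import Literature.NumberTheory.EllipticCurves.TateCurve.NumberFieldUniformization
import Literature.NumberTheory.EllipticCurves.TateCurve.NumberFieldUniformizationTwisted
import Literature.NumberTheory.DiophantineGeometry.LocalReduction
import HarnessLib

/-!
# Crux 3 `MazurMCOnCellB` (stmt-BirchSwinnertonDyer-19033), line `twistback` v4 — STRUCTURE of the non-split
# sub-row: an elliptic curve over `ℚ` with a rational `3`-isogeny, semistable away from `3` and multiplicative at `3`
# is SPLIT multiplicative at `3`; so every non-split X2b pair `(W, 3)` has an ADDITIVE place

Width seat bsd-line-x2-p1-w3 (gen 10), cell `bsd-eis` (run/shared/lean/pub/bsd-eis/), 2026-08-28. HONEST FRAMING: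
unconditional tool theorems (no `def`, no named fact, no `sorry`); every input is a tree THEOREM (Kronecker–Weber,
the Tate line at `3 ‖ N`, unipotent inertia at multiplicative places are PROVED in the tree); `--supports`
stmt-BirchSwinnertonDyer-19033; closes no registered stub; no summit statement, no Mazur main conjecture and no BSD is
proved for any curve; 0 cells / labels / tiers move.

WHY. The doors of LEAD bsd-line-x2-p1 g11 (`…TwistbackSubrowPartner{,Given,AnyLine}`, p655083 / p655437) serve the
sub-row «`p = 3`, `3` NON-split, local balance one» of row A10 (44 non-split cells). Which curves live there? Width
seat x1-p1-w2 g5's `FullDescentMultiplicativeUnipotentLine.lineCharacter_three_dichotomy_of_good_or_mult` says that the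
character of a rational `3`-line of a curve with good or multiplicative reduction at every `v ∤ 3` is `𝟙` or `χ̄₃`;
with the Weil relation `φψ = ω` (w7) the presenting Dirichlet characters are then `(𝟙, θ₃)` or `(θ₃, 𝟙)`, of levels
`(1, 3)` / `(3, 1)`. But at a NON-split multiplicative `3` the unramified one of `φ`, `ψ` takes the value `−1` at `3`
(w7's `psi_natCast_eq_neg_one_of_not_split` / `phi_natCast_eq_neg_one_of_not_split_of_lineUnramifiedAt`), not `1`.
Hence:

* §1 `level_eq_one_of_forall_apply_eq_one` — a PRIMITIVE Dirichlet presentation of the trivial Galois character has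
  level `1` (surjectivity of `χ_d`, `conductor_one`).
* §2 **`hasSplitMultiplicativeReductionAtPrime_three_of_red`** — `W/ℚ` globally minimal with `E[3]` reducible
  (`Red W 3`), multiplicative at `3`, good-or-multiplicative at every `v ∤ 3` ⟹ SPLIT multiplicative at `3`.
* §3 **`exists_hasAdditiveReductionAt_of_classX2_three_of_not_split`** — an X2 pair `(W, 3)` with `3` NON-split has a
  place `v ∤ 3` of ADDITIVE reduction; `not_semistable_of_cellB_three_of_not_split` — in particular no curve of the
  non-split X2b sub-row is semistable: every display through the doors needs the additive-place terms of the balance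
  (w7's `balanceTerm_of_hasAdditiveReductionAt_of_dvd` when both characters ramify there, the raw indicator otherwise),
  and a «semistable `c(E) = Σ_{split ℓ} s_ℓ`» door would be VACUOUS on this sub-row (recorded; not built).

References: [GreenbergVatsal2000] §2 pp. 26–28 (`Φ`, `Ψ`, `φψ = ω`); [SilvermanATAEC1994] Thm. V.5.3, Cor. V.5.4,
Ex. 5.13 (b); [SerreInventiones1972] §1.12, §5; [Mazur1978] §5; [Washington1997] Ch. 3.
-/

set_option autoImplicit false
-- `Summit.BirchSwinnertonDyer.BirchSwinnertonDyer.…`: the summit and its single sub-problem share a name.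
set_option linter.dupNamespace false

noncomputable section

open scoped Classical

open NumberField IsDedekindDomain Field WeierstrassCurve
  Literature.NumberTheory.EllipticCurves Literature.NumberTheory.GaloisRepresentations
  Literature.NumberTheory.EllipticCurves.TateCurve
  Literature.NumberTheory.EllipticCurves.Rank1Residual
  Summit.BirchSwinnertonDyer.Rank1Residual Summit.BirchSwinnertonDyer.Rank1Residual.X2
  Summit.BirchSwinnertonDyer.Rank1Residual.X2.PrimeOrderCharacters
  Summit.BirchSwinnertonDyer.Rank1Residual.X2.ResidualLineCharacters
  Summit.BirchSwinnertonDyer.BirchSwinnertonDyer.Theorems.FullDescentMultiplicativeUnipotentLine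
  Summit.BirchSwinnertonDyer.BirchSwinnertonDyer.Theorems.EisensteinPrimesLineCharactersWeilRelation
  Summit.BirchSwinnertonDyer.BirchSwinnertonDyer.Theorems.EisensteinPrimesLinePsiAtMultiplicativePrime
  Summit.BirchSwinnertonDyer.BirchSwinnertonDyer.Theorems.EisensteinPrimesLinePhiAtMultiplicativePrime

namespace Summit.BirchSwinnertonDyer.BirchSwinnertonDyer.Theorems.EisensteinPrimesMazurMCOnCellBNonsplitHasAdditivePlace

/-! ## §1. A primitive presentation of the trivial Galois character has level `1` -/

/-- **A primitive Dirichlet character presenting the TRIVIAL character of `Γ_ℚ` has level `1`**: if `θ` is primitive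
modulo `n` with values in `𝔽_p` and `θ(χ_n(σ)) = 1` for every `σ ∈ Γ_ℚ`, then `n = 1` (the cyclotomic character
`χ_n : Γ_ℚ → (ℤ/n)ˣ` is onto, so `θ = 1`, whose conductor is `1`). [cite: Washington1997, Ch. 3 (conductor of the trivial character)] -/
theorem level_eq_one_of_forall_apply_eq_one {p : ℕ} {n : ℕ} [NeZero n] {θ : DirichletCharacter (ZMod p) n}
    (hθ : θ.IsPrimitive)
    (h : ∀ σ : absoluteGaloisGroup ℚ, θ ((modNCyclotomicCharacter ℚ n σ : (ZMod n)ˣ) : ZMod n) = 1) :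
    n = 1 := by
  have h1 : θ = 1 := by
    apply MulChar.ext
    intro a
    obtain ⟨σ, hσ⟩ := modNCyclotomicCharacter_rat_surjective n a
    rw [MulChar.one_apply_coe, ← hσ, h σ]
  have hc : θ.conductor = n := hθ
  rw [← hc, h1, DirichletCharacter.conductor_one]

/-! ## §2. A rational `3`-isogeny + semistable away from `3` + multiplicative at `3` ⟹ SPLIT at `3` -/

section Split

variable (W : WeierstrassCurve ℚ) [W.IsElliptic] [W.IsGloballyMinimal]

/-- **An elliptic curve over `ℚ` with `E[3]` reducible, good-or-multiplicative reduction at every place `v ∤ 3` and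
multiplicative reduction at `3` is SPLIT multiplicative at `3`.** Take a rational `3`-line `Φ₀` (it exists:
`exists_isRationalLine_of_not_irr`) with primitive presentations `φ` mod `m` (line) and `ψ` mod `d` (quotient)
(Kronecker–Weber, `ResidualLineCharacters.exists_character_sub/_quot`). By x1-p1-w2 g5's
`lineCharacter_three_dichotomy_of_good_or_mult` the line character is `𝟙` or `χ̄₃`; by the Weil relation
(`apply_mul_apply_eq_modNCyclotomicCharacter`, w7) the quotient character is then `χ̄₃` resp. `𝟙`, and a primitive
presentation of `𝟙` has level `1` (§1). Suppose `3` were NON-split. If `Φ₀` is ramified at `3` its character is not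
`𝟙`, so `ψ` has level `d = 1` and `ψ(3) = 1` — but w7's `psi_natCast_eq_neg_one_of_not_split` gives `ψ(3) = −1`. If
`Φ₀` is unramified at `3` then `ψ` is ramified there (`3 ∣ d`, the Tate line at `3 ‖ N`:
`ResidualLineCharactersOdd.dvd_level_quot_of_lineUnramifiedAt`), so `d ≠ 1`, the line character is `𝟙`, `m = 1`,
`φ(3) = 1` — but w7's `phi_natCast_eq_neg_one_of_not_split_of_lineUnramifiedAt` gives `φ(3) = −1`. (Classical: a
rational `3`-torsion point, or a `μ₃`-line, forces split reduction at a multiplicative `3`.)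
[cite: SerreInventiones1972, §1.12 and §5 (semistable curves: the isogeny characters are unramified outside p)]
[cite: SilvermanATAEC1994, Thm. V.5.3 and Cor. V.5.4 (Tate curve at a multiplicative prime)]
[cite: GreenbergVatsal2000, §2 p. 28 (φψ = ω)] -/
theorem hasSplitMultiplicativeReductionAtPrime_three_of_red (hred : Red W 3)
    (hmult : W.HasMultiplicativeReductionAtPrime 3)
    (hsst : ∀ v : HeightOneSpectrum (𝓞 ℚ), ((3 : ℕ) : 𝓞 ℚ) ∉ v.asIdeal →
      W.HasGoodReductionAt v ∨ W.HasMultiplicativeReductionAt v) :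
    W.HasSplitMultiplicativeReductionAtPrime 3 := by
  by_contra hns
  -- a rational `3`-line and its primitive presentations
  obtain ⟨Φ₀, hΦ⟩ := exists_isRationalLine_of_not_irr (W := W) (p := 3) hred
  obtain ⟨m, _, φ, hφ, -, hφ0⟩ := exists_character_sub hΦ
  obtain ⟨d, _, ψ, hψ, -, hψ0⟩ := exists_character_quot hΦ
  -- a non-zero point of the line and the line character as a hom
  haveI : Finite Φ₀ := Nat.finite_of_card_ne_zero (by rw [hΦ.1]; decide)
  haveI : Nontrivial Φ₀ := Finite.one_lt_card_iff_nontrivial.mp (by rw [hΦ.1]; decide)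
  obtain ⟨⟨P, hPΦ⟩, hP⟩ := exists_ne (0 : Φ₀)
  have hP0 : P ≠ 0 := fun h ↦ hP (Subtype.ext h)
  have hr : ∀ σ : absoluteGaloisGroup ℚ, σ • P =
      ((φ.toUnitHom.comp (modNCyclotomicCharacter ℚ m) σ : (ZMod 3)ˣ) : ZMod 3).val • P :=
    fun σ ↦ by rw [coe_toUnitHom_comp]; exact hφ0 σ P hPΦ
  -- the Weil relation
  have hW : ∀ σ : absoluteGaloisGroup ℚ,
      φ ((modNCyclotomicCharacter ℚ m σ : (ZMod m)ˣ) : ZMod m) *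
        ψ ((modNCyclotomicCharacter ℚ d σ : (ZMod d)ˣ) : ZMod d) =
      ((modNCyclotomicCharacter ℚ 3 σ : (ZMod 3)ˣ) : ZMod 3) :=
    apply_mul_apply_eq_modNCyclotomicCharacter hΦ φ ψ hφ0 hψ0
  -- the Tate line at `3 ‖ N`
  have hTate := IsogenyLineType.exists_tateLine_adicCompletionPrime W 3
    Silverman1994_thmV53_tateUniformisation_holds Silverman1994_thmV53_corV54_tateUniformisation_holds (by decide)
    hmult
  rcases lineCharacter_three_dichotomy_of_good_or_mult W hP0 hr hsst with h1 | hχ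
  · -- line character trivial: the line is unramified, `φ` has level `1`, `φ(3) = 1 ≠ −1`
    have hφ1 : ∀ σ : absoluteGaloisGroup ℚ, φ ((modNCyclotomicCharacter ℚ m σ : (ZMod m)ˣ) : ZMod m) = 1 :=
      fun σ ↦ by rw [← coe_toUnitHom_comp, h1 σ, Units.val_one]
    have hunr : LineUnramifiedAt W 3 Φ₀ := by
      intro v _ 𝔓 _ σ _ Q hQ
      rw [hφ0 σ Q hQ, hφ1 σ, ZMod.val_one, one_nsmul]
    have hm1 : m = 1 := level_eq_one_of_forall_apply_eq_one hφ hφ1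
    have hpm : ¬ 3 ∣ m := by rw [hm1]; decide
    have hφ3 : φ (3 : ZMod m) = -1 :=
      phi_natCast_eq_neg_one_of_not_split_of_lineUnramifiedAt (W := W) (p := 3) (by decide) hmult hns hΦ hunr φ hpm
        hφ0
    have hone : φ (3 : ZMod m) = 1 := by
      subst hm1
      rw [Subsingleton.elim (3 : ZMod 1) 1, map_one]
    rw [hone] at hφ3
    exact absurd hφ3 (by decide)
  · -- line character `χ̄₃`: `ψ` is trivial on `Γ_ℚ`, so `d = 1`; the line is ramified (else `3 ∣ d`); `ψ(3) = 1 ≠ −1`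
    have hψ1 : ∀ σ : absoluteGaloisGroup ℚ, ψ ((modNCyclotomicCharacter ℚ d σ : (ZMod d)ˣ) : ZMod d) = 1 := by
      intro σ
      have h := hW σ
      rw [← coe_toUnitHom_comp, hχ σ] at h
      -- `χ₃(σ) · ψ(χ_d σ) = χ₃(σ)` with `χ₃(σ)` a unit
      have hu : IsUnit (((modNCyclotomicCharacter ℚ 3 σ : (ZMod 3)ˣ) : ZMod 3)) := Units.isUnit _
      exact (mul_eq_left₀ hu.ne_zero).mp h
    have hd1 : d = 1 := level_eq_one_of_forall_apply_eq_one hψ hψ1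
    have hram : ¬ LineUnramifiedAt W 3 Φ₀ := fun hunr ↦ by
      have h3d : 3 ∣ d := ResidualLineCharactersOdd.dvd_level_quot_of_lineUnramifiedAt hΦ hTate hunr hψ0
      rw [hd1] at h3d
      exact absurd h3d (by decide)
    have hpd : ¬ 3 ∣ d := by rw [hd1]; decide
    have hψ3 : ψ (3 : ZMod d) = -1 :=
      psi_natCast_eq_neg_one_of_not_split (W := W) (p := 3) (by decide) hmult hns hΦ hram ψ hpd hψ0
    have hone : ψ (3 : ZMod d) = 1 := by
      subst hd1
      rw [Subsingleton.elim (3 : ZMod 1) 1, map_one]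
    rw [hone] at hψ3
    exact absurd hψ3 (by decide)

/-! ## §3. The non-split X2 / X2b sub-row at `3` consists of NON-semistable curves -/

/-- **An X2 pair `(W, 3)` with `3` NON-split has a place `v ∤ 3` of ADDITIVE reduction** (§2 + the reduction
trichotomy at each place). [cite: SerreInventiones1972, §1.12 and §5] [cite: SilvermanATAEC1994, Thm. V.5.3 and Cor. V.5.4] -/
theorem exists_hasAdditiveReductionAt_of_classX2_three_of_not_split (hX : ClassX2 W 3)
    (hns : ¬ W.HasSplitMultiplicativeReductionAtPrime 3) :
    ∃ v : HeightOneSpectrum (𝓞 ℚ), ((3 : ℕ) : 𝓞 ℚ) ∉ v.asIdeal ∧ W.HasAdditiveReductionAt v := by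
  by_contra h
  push Not at h
  refine hns (hasSplitMultiplicativeReductionAtPrime_three_of_red W hX.2.1 hX.2.2 fun v hv ↦ ?_)
  rcases hasGoodReductionAt_or_hasMultiplicativeReductionAt_or_hasAdditiveReductionAt v W with hg | hm | ha
  · exact Or.inl hg
  · exact Or.inr hm
  · exact absurd ha (h v hv)

/-- **No curve of the non-split X2b sub-row at `3` is semistable**: `X2.CellB W 3` with `3` non-split ⟹
`¬ Semistable W` (the additive place of `exists_hasAdditiveReductionAt_of_classX2_three_of_not_split` is a prime of
additive reduction). So every display through the sub-row doors carries additive-place terms in its balance, and the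
«semistable» specialisation of the balance (`c(E) = Σ_{split ℓ ≠ 3} s_ℓ`) is vacuous there.
[cite: SerreInventiones1972, §1.12 and §5] [cite: SilvermanAEC2009, VII.5 Prop. 5.1] -/
theorem not_semistable_of_cellB_three_of_not_split (hc : X2.CellB W 3)
    (hns : ¬ W.HasSplitMultiplicativeReductionAtPrime 3) : ¬ Semistable W := by
  intro hsst
  obtain ⟨v, hv3, hadd⟩ := exists_hasAdditiveReductionAt_of_classX2_three_of_not_split W hc.2.1 hns
  haveI : Fact (Rat.HeightOneSpectrum.primesEquiv v : ℕ).Prime := ⟨(Rat.HeightOneSpectrum.primesEquiv v).2⟩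
  rcases hsst (Rat.HeightOneSpectrum.primesEquiv v : ℕ) (Rat.HeightOneSpectrum.primesEquiv v).2 with hg | hm
  · have hgAt : W.HasGoodReductionAt v := (W.hasGoodReductionAtPrime_iff_hasGoodReductionAt_ringOfIntegers v).mp hg
    exact hadd.not_hasGoodReductionAt hgAt
  · have hmAt : W.HasMultiplicativeReductionAt v :=
      (W.hasMultiplicativeReductionAtPrime_iff_hasMultiplicativeReductionAt_ringOfIntegers v).mp hm
    exact hadd.not_hasMultiplicativeReductionAt hmAt


/-! ## §4. (appended) The same with the route's `Semistable` predicate -/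

omit [W.IsGloballyMinimal] in
/-- A SEMISTABLE curve (`Rank1Residual.Semistable`: good or multiplicative at every prime) is good-or-multiplicative
at every finite place `v` of `ℚ` (place form, via the tree's bridges
`hasGoodReductionAtPrime_iff_hasGoodReductionAt_ringOfIntegers` /
`hasMultiplicativeReductionAtPrime_iff_hasMultiplicativeReductionAt_ringOfIntegers`). [folklore]
[cite: SilvermanAEC2009, VII.5 Prop. 5.1] -/
theorem hasGoodReductionAt_or_hasMultiplicativeReductionAt_of_semistable (hsst : Semistable W)
    (v : HeightOneSpectrum (𝓞 ℚ)) : W.HasGoodReductionAt v ∨ W.HasMultiplicativeReductionAt v := by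
  haveI : Fact (Rat.HeightOneSpectrum.primesEquiv v : ℕ).Prime := ⟨(Rat.HeightOneSpectrum.primesEquiv v).2⟩
  rcases hsst (Rat.HeightOneSpectrum.primesEquiv v : ℕ) (Rat.HeightOneSpectrum.primesEquiv v).2 with hg | hm
  · exact Or.inl ((W.hasGoodReductionAtPrime_iff_hasGoodReductionAt_ringOfIntegers v).mp hg)
  · exact Or.inr ((W.hasMultiplicativeReductionAtPrime_iff_hasMultiplicativeReductionAt_ringOfIntegers v).mp hm)

/-- **A SEMISTABLE elliptic curve over `ℚ` with `E[3]` reducible and `3 ∣ N` is SPLIT multiplicative at `3`**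
(§2 with the route's `Semistable` predicate; multiplicativity at `3` is part of semistability once `3` is not a good
prime). [cite: SerreInventiones1972, §1.12 and §5] [cite: SilvermanATAEC1994, Thm. V.5.3 and Cor. V.5.4] -/
theorem hasSplitMultiplicativeReductionAtPrime_three_of_red_of_semistable (hsst : Semistable W) (hred : Red W 3)
    (hbad : ¬ W.HasGoodReductionAtPrime 3) : W.HasSplitMultiplicativeReductionAtPrime 3 := by
  have hmult : W.HasMultiplicativeReductionAtPrime 3 := (hsst 3 (by norm_num)).resolve_left hbad
  exact hasSplitMultiplicativeReductionAtPrime_three_of_red W hred hmult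
    fun v _ ↦ hasGoodReductionAt_or_hasMultiplicativeReductionAt_of_semistable W hsst v

/-- **On X2 at `p = 3`: semistable ⟹ split** (`ClassX2 W 3` = `3 ≠ 2 ∧ Red W 3 ∧ Mult W 3`). So the X2b/X2c
NON-split sub-rows at `3` contain no semistable curve, and on the semistable part of X2 at `3` the reduction at `3`
is split (trivial-zero side of the Mazur–Tate–Teitelbaum function). [cite: SerreInventiones1972, §1.12 and §5]
[cite: MazurTateTeitelbaum1986, §I.14 (split multiplicative = exceptional case)] -/
theorem hasSplitMultiplicativeReductionAtPrime_three_of_classX2_of_semistable (hsst : Semistable W)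
    (hX : ClassX2 W 3) : W.HasSplitMultiplicativeReductionAtPrime 3 :=
  hasSplitMultiplicativeReductionAtPrime_three_of_red W hX.2.1 hX.2.2
    fun v _ ↦ hasGoodReductionAt_or_hasMultiplicativeReductionAt_of_semistable W hsst v

end Split

end Summit.BirchSwinnertonDyer.BirchSwinnertonDyer.Theorems.EisensteinPrimesMazurMCOnCellBNonsplitHasAdditivePlace

end
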